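import Summits.BirchSwinnertonDyer.BirchSwinnertonDyer.Theorems.ManinLocalTwoThreeKummerDiamondStepTwoTwoTorsionFixed
import Summits.BirchSwinnertonDyer.BirchSwinnertonDyer.Theorems.ManinLocalTwoThreeShimuraQuotientConjugation
import Literature.NumberTheory.EllipticCurves.HeegnerPointReflectionProofs
import HarnessLib

/-!
# es's STEP 1–2, residual input (O) DISCHARGED: in the index-`4` world there is a quarter-lattice point `S₁ = π₀(ω/4)` whose Kummer class is ODD
# (`conj S₁ ≠ S₁`), with `2S₁ ∈ W₀(ℂ)[2]` fixed by `Aut(ℂ/ℚ)` (modulo F★ ∧ CES)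
(route `ManinLocalTwoThree`, crux C2 `ManinOddAtFour` stmt-BirchSwinnertonDyer-22967; cell bsd-f2-manin, prover p2 gen 21; the `S₁`-hypotheses of
`StepTwo.propositionA_of_reciprocity`; es g38 PROOF-Ees185-186 §4 «(Parity) … `δ(T₁)` is odd»; `--supports stmt-BirchSwinnertonDyer-22967`)

MECHANISM (lattice form of es's parity step).  In the index-`4` world the Néron lattice `Λ = Λ_{W₀}` is RECTANGULARLY GENERATED: `re ω ∈ Λ` and
`i·im ω ∈ Λ` for `ω ∈ Λ` (tree `re_mem_and_im_mul_I_mem_of_periodLatticeGamma1_eq_two_mul`, from `conj` acting trivially on `Λ₀/Λ₁ = Λ₀/2Λ₀`).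
* `im_eq_zero_of_half_im_mem` / `not_both_half_im_mem` — for a basis `ω₁, ω₂` of ANY period lattice, `i·im(ω₁)/2` and `i·im(ω₂)/2` are not both in `Λ`
  (taking imaginary parts gives a `2 × 2` integer system of ODD determinant forcing `im ω₁ = im ω₂ = 0`, against `ℝ`-independence);
* **`exists_odd_quarterPoint_of_index_four`** — hence some `ω ∈ {ω₁, ω₂}` has `i·im(ω)/2 ∉ Λ`, and `S₁ := π₀(ω/4)` satisfies `2·(2S₁) = 0`,
  `σ(2S₁) = 2S₁` for all `σ ∈ Aut(ℂ/ℚ)` (part (T2), `twoTorsion_fixed_of_index_four`) and `conj(S₁) = π₀(conj ω/4) ≠ S₁`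
  (`uniformize_conj`: `conj(ω/4) − ω/4 = −i·im(ω)/2 ∉ Λ`).
CONDITIONAL on F★ ∧ CES (statement-only printed facts, through (T2)); nothing about E-es-185, C2, Manin's conjecture or BSD is proved.  No definitions,
no sorry. [cite: Stevens1989, §2] [cite: SilvermanAEC2009, Prop. X.1.4] [cite: ConradEdixhovenStein2003, §6.1.2]
-/

set_option autoImplicit false
-- lint-debt: the directory name repeats the summit name (sibling precedent `ManinLocalTwoThreeKummerDiamondStepTwoTwoTorsionFixed.lean`)
set_option linter.dupNamespace false

noncomputable section

open scoped MatrixGroups ComplexConjugate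
open CongruenceSubgroup WeierstrassCurve Literature.NumberTheory.EllipticCurves Literature.NumberTheory.EllipticCurves.ModularForms

namespace Summit.BirchSwinnertonDyer.BirchSwinnertonDyer.Theorems.ManinLocalTwoThree.StepTwo

/-! ## §1 The lattice lemma: `i·im(ω₁)/2`, `i·im(ω₂)/2` are not both lattice points -/

/-- If `i·im(ω₁)/2 ∈ Λ` and `i·im(ω₂)/2 ∈ Λ` then `im ω₁ = im ω₂ = 0` (odd determinant). [folklore] -/
theorem im_eq_zero_of_half_im_mem (L : PeriodPair) (h₁ : (L.ω₁.im : ℂ) * Complex.I / 2 ∈ L.lattice)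
    (h₂ : (L.ω₂.im : ℂ) * Complex.I / 2 ∈ L.lattice) : L.ω₁.im = 0 ∧ L.ω₂.im = 0 := by
  obtain ⟨a, b, hab⟩ := PeriodPair.mem_lattice.mp h₁
  obtain ⟨c, d, hcd⟩ := PeriodPair.mem_lattice.mp h₂
  have e₁ := congrArg Complex.im hab
  have e₂ := congrArg Complex.im hcd
  simp only [Complex.add_im, Complex.mul_im, Complex.intCast_re, Complex.intCast_im, zero_mul, add_zero,
    Complex.div_ofNat_im, Complex.ofReal_re, Complex.ofReal_im, Complex.I_re, Complex.I_im, mul_zero, mul_one] at e₁ e₂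
  -- `e₁ : a·im₁ + b·im₂ = im₁/2`, `e₂ : c·im₁ + d·im₂ = im₂/2`
  set D : ℤ := (2 * a - 1) * (2 * d - 1) - 4 * b * c with hD
  have hDodd : Odd D := ⟨2 * a * d - a - d - 2 * b * c, by rw [hD]; ring⟩
  have hDne : D ≠ 0 := by
    rintro h; rw [h] at hDodd; exact (by decide : ¬ Odd (0 : ℤ)) hDodd
  have hD0 : (D : ℝ) ≠ 0 := by exact_mod_cast hDne
  have k₁ : (D : ℝ) * L.ω₁.im = 0 := by rw [hD]; push_cast; linear_combination (2 * (2 * d - 1)) * e₁ - 4 * b * e₂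
  have k₂ : (D : ℝ) * L.ω₂.im = 0 := by rw [hD]; push_cast; linear_combination (2 * (2 * a - 1)) * e₂ - 4 * c * e₁
  exact ⟨(mul_eq_zero.mp k₁).resolve_left hD0, (mul_eq_zero.mp k₂).resolve_left hD0⟩

/-- **`i·im(ω₁)/2` and `i·im(ω₂)/2` are not both in `Λ`** (else `ω₁, ω₂` would be real, hence `ℝ`-dependent). [folklore] -/
theorem not_both_half_im_mem (L : PeriodPair) :
    ¬ ((L.ω₁.im : ℂ) * Complex.I / 2 ∈ L.lattice ∧ (L.ω₂.im : ℂ) * Complex.I / 2 ∈ L.lattice) := by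
  rintro ⟨h₁, h₂⟩
  obtain ⟨i₁, i₂⟩ := im_eq_zero_of_half_im_mem L h₁ h₂
  set r₁ : ℝ := L.ω₁.re with hr₁
  set r₂ : ℝ := L.ω₂.re with hr₂
  have hω₁ : L.ω₁ = (r₁ : ℂ) := by rw [← Complex.re_add_im L.ω₁, i₁, ← hr₁]; simp
  have hω₂ : L.ω₂ = (r₂ : ℂ) := by rw [← Complex.re_add_im L.ω₂, i₂, ← hr₂]; simp
  have hdep : r₂ • L.ω₁ + (-r₁) • L.ω₂ = 0 := by
    rw [hω₁, hω₂, Complex.real_smul, Complex.real_smul]; push_cast; ring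
  obtain ⟨-, h1⟩ := LinearIndependent.pair_iff.mp L.indep _ _ hdep
  have hz : L.ω₁ = 0 := by rw [hω₁, neg_eq_zero.mp h1]; simp
  exact L.indep.ne_zero 0 (by simpa using hz)

/-! ## §2 The odd quarter-lattice point -/

variable {W₀ : WeierstrassCurve ℚ} [W₀.IsElliptic] {N : ℕ} [NeZero N]

/-- Complex conjugation: the tree's `conjRatAlgHom` is the coercion of `Complex.conjAe.restrictScalars ℚ`. [folklore] -/
theorem coe_conjAe_restrictScalars_eq_conjRatAlgHom :
    ((Complex.conjAe.restrictScalars ℚ : ℂ ≃ₐ[ℚ] ℂ) : ℂ →ₐ[ℚ] ℂ) = conjRatAlgHom := by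
  apply AlgHom.ext; intro z; rfl

omit [W₀.IsElliptic] in
/-- `π₀` commutes with complex conjugation, in the `Complex.conjAe.restrictScalars ℚ` currency (tree `uniformize_conj`). [folklore] -/
theorem map_conj_uniformize (D₀ : ModularParametrizationData W₀ N) (z : ℂ) :
    Affine.Point.map (W' := W₀) ((Complex.conjAe.restrictScalars ℚ : ℂ ≃ₐ[ℚ] ℂ) : ℂ →ₐ[ℚ] ℂ) (D₀.uniformize z) = D₀.uniformize (conj z) := by
  rw [coe_conjAe_restrictScalars_eq_conjRatAlgHom, uniformize_conj D₀ z]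

/-- **(O) An odd Kummer class exists in the index-`4` world**: there is `S₁ = π₀(ω/4)` with `2·(2S₁) = 0`, `2S₁` fixed by `Aut(ℂ/ℚ)`, and
`conj S₁ ≠ S₁`.  CONDITIONAL on F★ ∧ CES (through (T2)). [cite: Stevens1989, §2] [cite: SilvermanAEC2009, Prop. X.1.4] -/
theorem exists_odd_quarterPoint_of_index_four (hF : optimalGamma1Parametrization_cusp_rational) (hCES : exists_optimal_gamma1ParametrizationData)
    [W₀.IsGloballyMinimal] (D₀ : ModularParametrizationData W₀ N) (hopt : ∀ z ∈ D₀.L.lattice, ∃ w ∈ periodLattice D₀.f, z = D₀.c * w)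
    (hN4 : 2 ^ 2 ∣ N) (h4 : ∀ z : ℂ, z ∈ periodLatticeGamma1 D₀.f ↔ ∃ w ∈ periodLattice D₀.f, z = 2 * w) :
    ∃ S₁ : (W₀.baseChange ℂ).toAffine.Point, 2 • (2 • S₁) = 0 ∧ IsOfFinAddOrder (2 • S₁) ∧
      (∀ σ : ℂ ≃ₐ[ℚ] ℂ, Affine.Point.map (W' := W₀) (σ : ℂ →ₐ[ℚ] ℂ) (2 • S₁) = 2 • S₁) ∧
      Affine.Point.map (W' := W₀) ((Complex.conjAe.restrictScalars ℚ : ℂ ≃ₐ[ℚ] ℂ) : ℂ →ₐ[ℚ] ℂ) S₁ ≠ S₁ := by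
  -- a basis vector `ω` with `i·im(ω)/2 ∉ Λ`
  obtain ⟨ω, hω, hη⟩ : ∃ ω ∈ D₀.L.lattice, (ω.im : ℂ) * Complex.I / 2 ∉ D₀.L.lattice := by
    by_cases h₁ : (D₀.L.ω₁.im : ℂ) * Complex.I / 2 ∈ D₀.L.lattice
    · exact ⟨D₀.L.ω₂, D₀.L.ω₂_mem_lattice, fun h₂ ↦ not_both_half_im_mem D₀.L ⟨h₁, h₂⟩⟩
    · exact ⟨D₀.L.ω₁, D₀.L.ω₁_mem_lattice, h₁⟩
  refine ⟨D₀.uniformize (ω / 4), ?_, ?_, ?_, ?_⟩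
  · rw [← map_nsmul, ← map_nsmul, D₀.uniformize_eq_zero_iff]
    convert hω using 1
    simp only [nsmul_eq_mul]; push_cast; ring
  · refine isOfFinAddOrder_iff_nsmul_eq_zero.mpr ⟨2, two_pos, ?_⟩
    rw [← map_nsmul, ← map_nsmul, D₀.uniformize_eq_zero_iff]
    convert hω using 1
    simp only [nsmul_eq_mul]; push_cast; ring
  · intro σ
    refine twoTorsion_fixed_of_index_four hF hCES D₀ hopt hN4 h4 _ ?_ σ
    rw [← map_nsmul, ← map_nsmul, D₀.uniformize_eq_zero_iff]
    convert hω using 1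
    simp only [nsmul_eq_mul]; push_cast; ring
  · rw [map_conj_uniformize, Ne, uniformize_eq_uniformize_iff]
    intro hmem
    apply hη
    have e : conj (ω / 4) - ω / 4 = -((ω.im : ℂ) * Complex.I / 2) := by
      have h := Complex.sub_conj (ω / 4)
      rw [Complex.div_ofNat_im] at h
      have h' : conj (ω / 4) - ω / 4 = -(((2 * (ω.im / 4) : ℝ) : ℂ) * Complex.I) := by rw [← h]; ring
      rw [h']; push_cast; ring
    rw [e, neg_mem_iff] at hmem
    exact hmem

end Summit.BirchSwinnertonDyer.BirchSwinnertonDyer.Theorems.ManinLocalTwoThree.StepTwo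

end
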